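import Summits.QuantumFields.YangMills.Theses.BalabanLadder
import Summits.QuantumFields.YangMills.Theses.BalabanFamilyExport

/-!
# Line `volume_split` on crux `UVSeamRec` (item stmt-QuantumFields-20043) — D-0145 ideator ym-idea-9 g0, LINE 2 (lens «complete»)

Sub-route of `route-QuantumFields-BalabanFamilyExport` (rev 1, 2026-08-28T03:5xZ): the volume seam `FamilySeam` (25033) is SPLIT by
physical size into `FiniteVolumeOddCeilings` (25260: continuum-limit E0′ on odd tori of bounded physical size, ∀ℓ₀, unconditional —
the landable-first half asked by idea-crit-5 NOTE #35 (iii)) and `ThermodynamicTransfer` (25259: class ceilings ⇒ ∃ℓ₀ beyond which the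
odd-torus ceilings hold; RP-chessboard homogenisation on the odd torus + parity-blind pressure increments, no IR input), glued by
`FamilySeamGlue` (25261, provable now — proof below, `familySeam_of_split`). The four stubs are route items; `UVSeamRec_of` concludes
the crux BY NAME through the route's `closes`. `UV` stays idle by necessity (flat junk data inhabit the (B)-pins). No summit is proved.
-/

namespace Summit.QuantumFields.YangMills.Cruxes.UVSeamRec.VolumeSplit

open Summit.QuantumFields.YangMills.Theses
open Summit.QuantumFields.YangMills.Theses.BalabanFamilyExport

/-- stub = route item `BalabanFamilyExport.FamilyCeilings` (stmt-QuantumFields-25032; shared with line `family_export`). -/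
theorem stub_familyCeilings : FamilyCeilings := by
  sorry

/-- stub = route item `BalabanFamilyExport.FiniteVolumeOddCeilings` (stmt-QuantumFields-25260). -/
theorem stub_finiteVolumeOddCeilings : FiniteVolumeOddCeilings := by
  sorry

/-- stub = route item `BalabanFamilyExport.ThermodynamicTransfer` (stmt-QuantumFields-25259). -/
theorem stub_thermodynamicTransfer : ThermodynamicTransfer := by
  sorry

/-- stub = route item `BalabanFamilyExport.FloorsEngine` (stmt-QuantumFields-25034; v5(α) `stub_floorsEngine` verbatim; shared). -/
theorem stub_floorsEngine : FloorsEngine := by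
  sorry

/-- the glue item `FamilySeamGlue` (stmt-QuantumFields-25261), PROVED: case split on the physical size of the odd torus. -/
theorem familySeam_of_split : ThermodynamicTransfer → FiniteVolumeOddCeilings → FamilySeam := by
  intro hT hF L hLodd hL hcl
  obtain ⟨ℓ₀, hℓ₀, C₁, β₁, ℓ₁, hℓ₁, hC₁, h₁⟩ := hT L hLodd hL hcl
  obtain ⟨C₂, β₂, ℓ₂, hℓ₂, hC₂, h₂⟩ := hF ℓ₀ hℓ₀
  refine ⟨max C₁ C₂, max β₁ β₂, min ℓ₁ ℓ₂, lt_min hℓ₁ hℓ₂, le_max_of_le_left hC₁, ?_⟩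
  intro β hβ S n q x R hq hR hRu hRS hsep
  have hR4 : (0 : ℝ) < (R : ℝ) ^ 4 := by positivity
  by_cases hsz : ((2 * S + 1 : ℕ) : ℝ) * Summit.QuantumFields.YangMills.Cruxes.UVSeamRec.Transport.uRec β ≤ ℓ₀
  · have := h₂ β (le_trans (le_max_right _ _) hβ) S n q x R hq hR (le_trans hRu (min_le_right _ _)) hRS hsz hsep
    refine le_trans this (pow_le_pow_left₀ (div_nonneg hC₂ hR4.le) ?_ n)
    exact div_le_div_of_nonneg_right (le_max_right _ _) hR4.le
  · have hge : ℓ₀ ≤ ((2 * S + 1 : ℕ) : ℝ) * Summit.QuantumFields.YangMills.Cruxes.UVSeamRec.Transport.uRec β :=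
      le_of_lt (lt_of_not_ge hsz)
    have := h₁ β (le_trans (le_max_left _ _) hβ) S n q x R hq hR (le_trans hRu (min_le_left _ _)) hRS hge hsep
    refine le_trans this (pow_le_pow_left₀ (div_nonneg hC₁ hR4.le) ?_ n)
    exact div_le_div_of_nonneg_right (le_max_left _ _) hR4.le

/-- the glue item itself, by name. -/
theorem familySeamGlue_holds : FamilySeamGlue := familySeam_of_split

/-- kernel-checked composition: the four stubs give the crux `UVSeamRec` BY NAME (route `closes` ∘ split glue). -/
theorem UVSeamRec_of :
    FamilyCeilings → FiniteVolumeOddCeilings → ThermodynamicTransfer → FloorsEngine →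
      Summit.QuantumFields.YangMills.Theses.BalabanLadder.UVSeamRec :=
  fun h₁ hF hT h₃ => BalabanFamilyExport.closes h₁ (familySeam_of_split hT hF) h₃

/-- the crux from the stubs. -/
theorem UVSeamRec_holds_of_stubs : Summit.QuantumFields.YangMills.Theses.BalabanLadder.UVSeamRec :=
  UVSeamRec_of stub_familyCeilings stub_finiteVolumeOddCeilings stub_thermodynamicTransfer stub_floorsEngine

end Summit.QuantumFields.YangMills.Cruxes.UVSeamRec.VolumeSplit
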